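import Summits.CriticalPhenomena.PercolationContinuityZ3.Theorems.PercNearOneGluingNoHeavyConstsMDLXJointTwoOneClass
import Summits.CriticalPhenomena.PercolationContinuityZ3.Theorems.PercNearOneGluingNoHeavyConstsMarkerSplit
import HarnessLib

/-!
# GAIN ≥ 0: the MDL(X)′ margin at the marker-avoidance event `{y ↮ X}` is nonnegative (PAPER-2 track (ii), seat `prim-consts-2`, gen 20)

builds on p205010 (kernel theorem, internal audit signed; external expert review pending).  Support file (`--supports
stmt-CriticalPhenomena-4575`); one theorem, no sorries, standard axioms.  Companion of `…ConstsMDLXJointAvoidSplit.lean` (it is the factor `G ≥ 0`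
of the marker-avoidance split) and of `…ConstsMDLXJointXEdgeInduction.lean` (memo FROM-prim-consts-2-g18-XEDGE-CROSS.md §0(5): "GAIN ≥ 0", the
input of the single-pair member at the marker pair, there taken as an instance of the induction hypothesis).

With `D = {s↮X}`, `T = {y↮{s}∪X}∩D`, `W = {y↔z}`, `Y = {s↔y}`, `Z = {s↔z}`, `A = {y↮X}`, `E₁ = D∩A`, `ν = μ(·|D)`, `p' = μ(T∩W)/μ(T)`:
* `Consts.mdlx_gain_nonneg` — **`μ(T∩W)·[μ(D)μ(D∩Y) − μ(E₁)μ(D∩Y)] ≤ μ(T)·[μ(D)μ(E₁∩Z) − μ(E₁)μ(D∩Z)]`**, i.e. `Cov_ν(1_A, 1_Z) ≥ p'·Cov_ν(1_A, 1_Y)`,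
  i.e. `ν(Q)·[ν(Z) − p'ν(Y)] ≥ ν(Z∩Q)` (`Q = Aᶜ`): the `Consts.MDLXJoint` inequality at the ANTITONE `C_X`-functional `1{y ∉ V(C_X)}`.
  Proof: by van den Berg–Häggström–Kahn's Lemma 2.4 (the tower reduction `Consts.mdlxJoint_jointClass_of_at`) it is the MDL(X)′ inequality at the
  conditional mean `ĝ(K) = P(y ↮ X off B(K))`, an increasing functional of `K = C_s` with `ĝ ≡ 1` on `{y ∈ V(K)}` — the proved class `C0 ≤ 0` of
  `Consts.mdlxJoint_of_lowerMarker_le` (gen 16).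
[cite: VandenbergHaggstromKahn2005, §2.1 Lemma 2.4 (p. 10), Thm. 1.3 (p. 6), Thm. 1.4 (p. 7)]
-/

noncomputable section

namespace Summit.CriticalPhenomena.PercolationContinuityZ3.Theorems

open MeasureTheory Set Literature.Probability.LatticeModels Literature.Probability.Percolation
open scoped Classical
open BHK2006

namespace Consts

variable {V : Type*} [Fintype V]

/-- **GAIN ≥ 0** — the `Consts.MDLXJoint` inequality at the functional `1{y ↮ X}` (read on the cluster of `X`), unconditionally:
`μ(T∩W)·[μ(D)μ(D∩Y) − μ(D∩A)μ(D∩Y)] ≤ μ(T)·[μ(D)μ(D∩A∩Z) − μ(D∩A)μ(D∩Z)]` (`A = {y ↮ X}`; on `D`, `{s↔y} ⊆ A`).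
[cite: VandenbergHaggstromKahn2005, §2.1 Lemma 2.4 (p. 10), Thm. 1.3 (p. 6)] -/
theorem mdlx_gain_nonneg (w : Sym2 V → unitInterval) (s y z : V) (X : Set V) :
    (prodBernoulli w).real ({ω : BondConfig V | ∀ x ∈ insert s X, ¬ (openGraph ω).Reachable y x} ∩
          {ω | ∀ x ∈ X, ¬ (openGraph ω).Reachable s x} ∩ openConn y z) *
        ((prodBernoulli w).real {ω : BondConfig V | ∀ x ∈ X, ¬ (openGraph ω).Reachable s x} *
            (prodBernoulli w).real ({ω : BondConfig V | ∀ x ∈ X, ¬ (openGraph ω).Reachable s x} ∩ openConn s y) -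
          (prodBernoulli w).real ({ω : BondConfig V | ∀ x ∈ X, ¬ (openGraph ω).Reachable s x} ∩ {ω | ∀ x ∈ X, ¬ (openGraph ω).Reachable y x}) *
            (prodBernoulli w).real ({ω : BondConfig V | ∀ x ∈ X, ¬ (openGraph ω).Reachable s x} ∩ openConn s y)) ≤
      (prodBernoulli w).real ({ω : BondConfig V | ∀ x ∈ insert s X, ¬ (openGraph ω).Reachable y x} ∩
          {ω | ∀ x ∈ X, ¬ (openGraph ω).Reachable s x}) *
        ((prodBernoulli w).real {ω : BondConfig V | ∀ x ∈ X, ¬ (openGraph ω).Reachable s x} *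
            (prodBernoulli w).real ({ω : BondConfig V | ∀ x ∈ X, ¬ (openGraph ω).Reachable s x} ∩ {ω | ∀ x ∈ X, ¬ (openGraph ω).Reachable y x} ∩
              openConn s z) -
          (prodBernoulli w).real ({ω : BondConfig V | ∀ x ∈ X, ¬ (openGraph ω).Reachable s x} ∩ {ω | ∀ x ∈ X, ¬ (openGraph ω).Reachable y x}) *
            (prodBernoulli w).real ({ω : BondConfig V | ∀ x ∈ X, ¬ (openGraph ω).Reachable s x} ∩ openConn s z)) := by
  classical
  set μ := prodBernoulli w with hμ
  have hmeas : ∀ S : Set (BondConfig V), MeasurableSet S := fun _ => MeasurableSet.of_discrete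
  set D : Set (BondConfig V) := {ω | ∀ x ∈ X, ¬ (openGraph ω).Reachable s x} with hD
  set Av : Set (BondConfig V) := {ω | ∀ x ∈ X, ¬ (openGraph ω).Reachable y x} with hAv
  set T : Set (BondConfig V) := {ω : BondConfig V | ∀ x ∈ insert s X, ¬ (openGraph ω).Reachable y x} ∩ D with hT
  set TW : Set (BondConfig V) := {ω : BondConfig V | ∀ x ∈ insert s X, ¬ (openGraph ω).Reachable y x} ∩ D ∩ openConn y z with hTW
  set Yv : Set (BondConfig V) := openConn s y with hYv
  set Zv : Set (BondConfig V) := openConn s z with hZv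
  have h0 : ∀ S : Set (BondConfig V), 0 ≤ μ.real S := fun _ => measureReal_nonneg
  -- the case `y ∈ X`: `T = ∅`
  by_cases hyX : y ∈ X
  · have hTe : T = ∅ := Set.eq_empty_of_forall_notMem fun ω hω => hω.1 y (mem_insert_of_mem s hyX) (SimpleGraph.Reachable.refl y)
    have hTWe : TW = ∅ := by rw [hTW, ← hT, hTe, empty_inter]
    change μ.real TW * _ ≤ μ.real T * _
    rw [hTe, hTWe, measureReal_empty, zero_mul, zero_mul]
  -- the two-cluster functional `f(K, L) = 1{y ∉ X, no edge of L contains y}` and its conditional mean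
  set f : Set (Sym2 V) → Set (Sym2 V) → ℝ := fun _ L => if (y ∉ X ∧ ∀ e ∈ L, y ∉ e) then 1 else 0 with hf
  have hf₁ : ∀ L, Monotone fun K => f K L := fun _ => monotone_const
  have hf₂ : ∀ K, Antitone fun L => f K L := by
    intro K L L' hLL'
    simp only [hf]
    by_cases h' : (y ∉ X ∧ ∀ e ∈ L', y ∉ e)
    · rw [if_pos h', if_pos ⟨h'.1, fun e he => h'.2 e (hLL' he)⟩]
    · rw [if_neg h']; split_ifs <;> norm_num
  have hf01 : ∀ K L, 0 ≤ f K L ∧ f K L ≤ 1 := by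
    intro K L; simp only [hf]; split_ifs <;> norm_num
  set fh : Set (Sym2 V) → ℝ := fun K => ∫ η, f K (setCl (η \ barOf ({s} : Set V) K) X) ∂μ with hfh
  have hfh_mono : Monotone fh := monotone_condJointFn w s X f hf₁ hf₂
  have hfh0 : ∀ K, 0 ≤ fh K := fun K => integral_nonneg fun η => (hf01 K (setCl (η \ barOf ({s} : Set V) K) X)).1
  have hfh1 : ∀ K, fh K ≤ 1 := by
    intro K
    have h := integral_mono (μ := μ) (f := fun η => f K (setCl (η \ barOf ({s} : Set V) K) X)) (g := fun _ => (1 : ℝ))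
      Integrable.of_finite Integrable.of_finite (fun η => (hf01 K (setCl (η \ barOf ({s} : Set V) K) X)).2)
    simpa using h
  -- `fh ≡ 1` on clusters meeting `y` (and at `y = s`)
  have hfh_one : ∀ K : Set (Sym2 V), (y = s ∨ ∃ e ∈ K, y ∈ e) → fh K = 1 := by
    intro K hK
    have hpt : ∀ η : BondConfig V, f K (setCl (η \ barOf ({s} : Set V) K) X) = 1 := by
      intro η
      simp only [hf]
      rw [if_pos]
      refine ⟨hyX, fun e he hye => ?_⟩
      obtain ⟨x, _, hex⟩ := (mem_setCl_iff _ X e).1 he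
      have heo : e ∈ η \ barOf ({s} : Set V) K := openEdgeCluster_subset _ x hex
      apply heo.2
      rcases hK with hys | ⟨e', he', hye'⟩
      · exact ⟨y, hye, Or.inl (hys ▸ rfl)⟩
      · exact ⟨y, hye, Or.inr ⟨e', he', hye'⟩⟩
    show ∫ η, f K (setCl (η \ barOf ({s} : Set V) K) X) ∂μ = 1
    simp_rw [hpt]; simp
  have hfh_oneY : ∀ ω ∈ Yv, fh (openEdgeCluster ω s) = 1 := fun ω hω =>
    hfh_one _ ((reachable_iff_exists_mem_openEdgeCluster ω s y).1 hω)
  -- reading `f(C_s, C_X)` as the indicator of `A`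
  have hfA : ∀ ω : BondConfig V, f (openEdgeCluster ω s) (⋃ t ∈ X, openEdgeCluster ω t) = Av.indicator 1 ω := by
    intro ω
    have hiff : (y ∉ X ∧ ∀ e ∈ (⋃ t ∈ X, openEdgeCluster ω t), y ∉ e) ↔ ω ∈ Av := by
      simp only [hAv, mem_setOf_eq, mem_iUnion, exists_prop]
      constructor
      · rintro ⟨_, hno⟩ x hx hr
        rcases (reachable_iff_exists_mem_openEdgeCluster ω x y).1 hr.symm with h | ⟨e, he, hye⟩
        · exact hyX (h ▸ hx)
        · exact hno e ⟨x, hx, he⟩ hye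
      · intro hA
        refine ⟨hyX, ?_⟩
        rintro e ⟨x, hx, he⟩ hye
        exact hA x hx ((reachable_iff_exists_mem_openEdgeCluster ω x y).2 (Or.inr ⟨e, he, hye⟩)).symm
    by_cases hω : ω ∈ Av
    · simp only [hf]; rw [if_pos (hiff.2 hω), indicator_of_mem hω, Pi.one_apply]
    · simp only [hf]; rw [if_neg (fun h => hω (hiff.1 h)), indicator_of_notMem hω]
  -- the three integrals of `f(C_s, C_X)` are masses
  have hI : ∀ S : Set (BondConfig V), ∫ ω in S, f (openEdgeCluster ω s) (⋃ t ∈ X, openEdgeCluster ω t) ∂μ = μ.real (S ∩ Av) := by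
    intro S; simp_rw [hfA]; exact KNPreFKG.setIntegral_indicator_one_eq μ S Av
  have hDY : D ∩ Yv ∩ Av = D ∩ Yv := by
    ext ω
    simp only [mem_inter_iff]
    constructor
    · rintro ⟨h, _⟩; exact h
    · rintro ⟨hD', hY⟩
      exact ⟨⟨hD', hY⟩, fun x hx hyx => hD' x hx ((hY : (openGraph ω).Reachable s y).trans hyx)⟩
  -- tower: the integrals of `f(C_s, C_X)` over `D`, `D∩Y`, `D∩Z` equal those of `fh(C_s)`
  have towY := (setIntegral_jointFn_reach_eq w s y X f).1
  have towZ := (setIntegral_jointFn_reach_eq w s z X f).1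
  have towD := (setIntegral_jointFn_reach_eq w s y X f).2
  -- degenerate case: `∫_{D∩N} (1 − fh) = 0` (then `μ(D ∖ A) = 0` and both sides agree)
  by_cases hKN : 0 < ∫ ω in D ∩ Yvᶜ, (1 - fh (openEdgeCluster ω s)) ∂μ
  swap
  · have hle : ∫ ω in D ∩ Yvᶜ, (1 - fh (openEdgeCluster ω s)) ∂μ ≤ 0 := le_of_not_gt hKN
    have hge : 0 ≤ ∫ ω in D ∩ Yvᶜ, (1 - fh (openEdgeCluster ω s)) ∂μ :=
      setIntegral_nonneg (hmeas _) fun ω _ => sub_nonneg.2 (hfh1 _)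
    have hzero : ∫ ω in D ∩ Yvᶜ, (1 - fh (openEdgeCluster ω s)) ∂μ = 0 := le_antisymm hle hge
    -- `∫_D fh = μ(D)`: on `D∩Y` `fh = 1`, on `D∩N` `∫(1 − fh) = 0`
    have hN : ∫ ω in D ∩ Yvᶜ, fh (openEdgeCluster ω s) ∂μ = μ.real (D ∩ Yvᶜ) := by
      have h := setIntegral_one_sub w (D ∩ Yvᶜ) (fun ω => fh (openEdgeCluster ω s))
      linarith
    have hYi : ∫ ω in D ∩ Yv, fh (openEdgeCluster ω s) ∂μ = μ.real (D ∩ Yv) := by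
      rw [setIntegral_congr_fun (hmeas _) (fun ω hω => hfh_oneY ω hω.2 : EqOn (fun ω => fh (openEdgeCluster ω s)) (fun _ => (1 : ℝ)) (D ∩ Yv)),
        setIntegral_const, smul_eq_mul, mul_one]
    have hDi : ∫ ω in D, fh (openEdgeCluster ω s) ∂μ = μ.real D := by
      have h := setIntegral_inter_add_compl w D Yv (fun ω => fh (openEdgeCluster ω s))
      have hm : μ.real (D ∩ Yv) + μ.real (D ∩ Yvᶜ) = μ.real D := by
        have h2 := measureReal_inter_add_sdiff (μ := μ) (s := D) (hmeas Yv); rwa [Set.sdiff_eq] at h2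
      linarith
    have hE : μ.real (D ∩ Av) = μ.real D := by rw [← hI D, towD, hDi]
    -- `μ(D ∩ Av ∩ Z) = μ(D ∩ Z)`
    have hEZ : μ.real (D ∩ Av ∩ Zv) = μ.real (D ∩ Zv) := by
      apply le_antisymm (measureReal_mono (show D ∩ Av ∩ Zv ⊆ D ∩ Zv from fun ω hω => ⟨hω.1.1, hω.2⟩))
      have h1 : μ.real (D ∩ Zv) + μ.real (D ∩ Zvᶜ) = μ.real D := by
        have h2 := measureReal_inter_add_sdiff (μ := μ) (s := D) (hmeas Zv); rwa [Set.sdiff_eq] at h2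
      have h2 : μ.real (D ∩ Av ∩ Zv) + μ.real (D ∩ Av ∩ Zvᶜ) = μ.real (D ∩ Av) := by
        have h3 := measureReal_inter_add_sdiff (μ := μ) (s := D ∩ Av) (hmeas Zv); rwa [Set.sdiff_eq] at h3
      have h3 : μ.real (D ∩ Av ∩ Zvᶜ) ≤ μ.real (D ∩ Zvᶜ) :=
        measureReal_mono (show D ∩ Av ∩ Zvᶜ ⊆ D ∩ Zvᶜ from fun ω hω => ⟨hω.1.1, hω.2⟩)
      linarith
    change μ.real TW * (μ.real D * μ.real (D ∩ Yv) - μ.real (D ∩ Av) * μ.real (D ∩ Yv)) ≤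
      μ.real T * (μ.real D * μ.real (D ∩ Av ∩ Zv) - μ.real (D ∩ Av) * μ.real (D ∩ Zv))
    rw [hE, hEZ]; simp
  -- main case: the lower-marker class theorem at `fh`, transported by the tower
  have hC0 : μ.real ({ω : BondConfig V | ∀ x ∈ insert s X, ¬ (openGraph ω).Reachable y x} ∩ D) *
        (∫ ω in D ∩ Yvᶜ, (1 - fh (openEdgeCluster ω s)) ∂μ) *
        (∫ ω in D ∩ Yv ∩ Zv, (1 - fh (openEdgeCluster ω s)) ∂μ) ≤
      (μ.real ({ω : BondConfig V | ∀ x ∈ insert s X, ¬ (openGraph ω).Reachable y x} ∩ D ∩ openConn y z) *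
          (∫ ω in D ∩ Yvᶜ, (1 - fh (openEdgeCluster ω s)) ∂μ) +
        μ.real ({ω : BondConfig V | ∀ x ∈ insert s X, ¬ (openGraph ω).Reachable y x} ∩ D) *
          (∫ ω in D ∩ Yvᶜ ∩ Zv, (1 - fh (openEdgeCluster ω s)) ∂μ)) *
      (∫ ω in D ∩ Yv, (1 - fh (openEdgeCluster ω s)) ∂μ) := by
    have hYZ0 : ∫ ω in D ∩ Yv ∩ Zv, (1 - fh (openEdgeCluster ω s)) ∂μ = 0 :=
      setIntegral_eq_zero_of_forall_eq_zero fun ω hω => by rw [hfh_oneY ω hω.1.2, sub_self]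
    have hY0 : ∫ ω in D ∩ Yv, (1 - fh (openEdgeCluster ω s)) ∂μ = 0 :=
      setIntegral_eq_zero_of_forall_eq_zero fun ω hω => by rw [hfh_oneY ω hω.2, sub_self]
    rw [hYZ0, hY0]; simp
  have key := mdlxJoint_of_lowerMarker_le w s y z X fh hfh_mono hfh0 hfh1 hKN hC0
  have h := mdlxJoint_jointClass_of_at w s y z X f key
  have hDZ : D ∩ Zv ∩ Av = D ∩ Av ∩ Zv := inter_right_comm D Zv Av
  rw [hI, hI, hI, hDY, hDZ] at h
  exact h

end Consts

end Summit.CriticalPhenomena.PercolationContinuityZ3.Theorems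

end
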